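import Mathlib
import Summits.Ventures.PercRepro2.GcParallel
import Summits.Ventures.PercRepro2.LeafRowCutOneFar

/-!
# The parallel reduction of row (LEAF-½): two parallel edges are one edge
(blind cell PercRepro2, p5 g29; `proofs/P5-OEDGE.md` §39 (7))

p1's parallel rule (`GcParallel.lean`: two parallel edges `g₁, g₂` are one edge of weight
`p_{g₁} + p_{g₂} − p_{g₁} p_{g₂}`, the other re-routed to a loop; `prob_parallel_pushforward` and
`openGraph_parallel`) transports the middle Bernstein coefficient `R½` of the leaf step exactly as
it transports `Gc` (`Gc_parallel`), through the marks-only transport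
`LeafRowCutOneFar.Rhalf_transport_marks'`:

* **`Rhalf_parallel`**: `R½(G) = R½(G with g₁, g₂ merged)` for every marking;
* **`LeafRow_parallel_iff`**: the row on `G` iff the row on the merged graph.

With `LeafRowSeries.LeafRow_series_iff` and `LeafDelete.LeafRow_update_loop`, a smallest
counterexample to row (LEAF-½) is a SIMPLE graph without unmarked vertices of degree ≤ 2.
Own work; standard axioms.
-/

namespace Summit.Ventures.PercRepro2

open UnionCluster CovForm LeafStep RECM

namespace LeafRowParallel

variable {V : Type*} {E : Type*} [Fintype E] [DecidableEq E] {R : Type*} [Field R]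

/-- **`R½` transports along the parallel rule**: two parallel edges `g₁, g₂` are one edge `g₁` of
weight `p_{g₁} + p_{g₂} − p_{g₁} p_{g₂}`, `g₂` re-routed to a loop at `u`. -/
theorem Rhalf_parallel (p : E → R) {ends : E → Sym2 V} {g₁ g₂ : E} (h12 : g₁ ≠ g₂)
    (hpar : ends g₂ = ends g₁) (u : V) (o a₁ a₂ w b : V) :
    Rhalf p ends o a₁ a₂ w b =
      Rhalf (Function.update (Function.update p g₁ (p g₁ + p g₂ - p g₁ * p g₂)) g₂ 0)
        (Function.update ends g₂ s(u, u)) o a₁ a₂ w b :=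
  (LeafRowCutOneFar.Rhalf_transport_marks' (prob_parallel_pushforward p h12) o a₁ a₂ w b
    (fun ω x _ z _ => by unfold Conn; rw [openGraph_parallel h12 hpar u ω])).symm

/-- **Row (LEAF-½) is invariant under the parallel rule.** -/
theorem LeafRow_parallel_iff [LinearOrder R] (p : E → R) {ends : E → Sym2 V} {g₁ g₂ : E}
    (h12 : g₁ ≠ g₂) (hpar : ends g₂ = ends g₁) (u : V) (o a₁ a₂ w b : V) :
    LeafRow p ends o a₁ a₂ w b ↔
      LeafRow (Function.update (Function.update p g₁ (p g₁ + p g₂ - p g₁ * p g₂)) g₂ 0)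
        (Function.update ends g₂ s(u, u)) o a₁ a₂ w b := by
  unfold LeafRow
  rw [Rhalf_parallel p h12 hpar u o a₁ a₂ w b]

end LeafRowParallel

end Summit.Ventures.PercRepro2
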